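import Summits.BirchSwinnertonDyer.Rank1Residual.Additive.UnramifiedAwayBadPlaces
import Summits.BirchSwinnertonDyer.Rank1Residual.Additive.UnramifiedKummerDoor
import HarnessLib

/-!
# The classical local condition over `K_∞` at EVERY `v ∤ p` is "locally trivial" — bad places
# included; with `UnramifiedAwayBadPlaces`: classical = trivial = unramified at every `v ∤ p`
# (the LINK `Sel_E(K_∞)_p ↔ S_A(K_∞)` at the bad `η ∤ p`; cell `b2b-bsdres`, team n1011, seat p06
# GEN 5; OWNERS row T-A240-PORT, item K2 (second half); referee nit `gvSelmer-SelmerDualData-link`)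

HONEST FRAMING (cell `b2b-bsdres`, run/shared/lean/b2b/bsd-rank1-residual/, verbatim in every
file): the goal of the cell is to DELETE the COMBINATION-SHAPED residual classes of the
Birch–Swinnerton-Dyer formula for ALL analytic-rank `≤ 1` elliptic curves over `ℚ` — "full BSD
formula for every rank `≤ 1` curve in class `C`" assembled STRICTLY from published theorems — so
that the rank-`≤ 1` remainder becomes exactly the CONSTRUCTION-SHAPED classes, which are TYPED
(missing-input `Prop`s), NOT attempted. This is not "finishing BSD". Team n1011: research routes on
CONSTRUCTION-SHAPED classes (ARM α / A240 discharge); census output = EVIDENCE, never a Literature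
fact; RESIDUAL-MAP marks UNCHANGED; nothing is booked by this file. THEOREMS ONLY: no definition,
no named fact.

## What and why

Greenberg (LNM 1716 §2, Prop. 2.1 and pp. 69–72; GV 2000 §2 p. 17): for `η ∤ p` the local Kummer
image `Im κ_η ⊆ H¹((K_∞)_η, E[p^∞])` VANISHES (`E((K_∞)_η) ⊗ ℚ_p/ℤ_p = 0`), so the CLASSICAL local
condition of `Sel_E(K_∞)_p` at `η` is "`[σ|G_η] = 0`"; and (GV p. 17) "`G_η/I_η` has profinite order
prime to `p`", so this is "`[σ|I_η] = 0`", the condition of `S_A(K_∞)`.  In the tree's currency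
(`H = ker κ`, `A = E[p^∞] = W.geomPrimaryTorsion p`):

* `WeierstrassCurve.localKerOver p H K_v` — the classical condition
  (dies in `H¹(H_{K_v}, E(K̄_v))`);
* `GreenbergSelmer.awayKer H A v` — dies on `H ⊓ D_v`;
* `GreenbergVatsalTorsion.unramKer H A v` — dies on `H ⊓ I_v` (GV's condition at `η ∤ p`).

The tree had `awayKer ≤ localKerOver` (X2, any `v`), `awayKer ≤ unramKer` (X2, any `v`),
`localKerOver ≤ unramKer` and `unramKer ≤ awayKer` at GOOD `v ∤ p` only (X2), and — this seat's
`UnramifiedAwayBadPlaces` (p287268) — `unramKer ≤ awayKer` at EVERY `v` unramified and not totally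
split in `K_∞/K`.  THIS FILE supplies the remaining inclusion with NO reduction hypothesis:

* `localKerOver_le_awayKer` — for ANY number field, ANY `ℤ_p`-extension `κ`, ANY `v ∤ p`, ANY
  elliptic curve: `W.localKerOver p (ker κ) K_v ≤ awayKer (ker κ) E[p^∞] v`.  Proof (Greenberg's
  `Im κ_η = 0`, made effective): a cocycle `f` of the class is `∂P` on `H_{K_v}` for some
  `P ∈ E(K̄_v)`; `f` has finitely many values (`H` compact), so `p^k f = 0` and `S = p^k P` is fixed
  by `H_{K_v}`; since `H_{K_v} ⊇ I_{K_v}` (`ℤ_p`-extensions are unramified at `v ∤ p`,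
  `absInertia_le_localSubgroup_kerSubgroup`), the cell's `exists_fixed_sub_pow_nsmul_mem_
  primaryComponent` (FILE A of row T-E3g-DOOR: `E(F)` is `p`-divisible modulo `p`-power torsion for
  `K_v ⊆ F ⊆ K_v^{ur}`) writes `S = p^k R + T` with `R` fixed and `T` of `p`-power order; then
  `Q = P − R` is a `p`-power torsion point, hence geometric, and `f = ∂Q` on `H ⊓ D_v`;
* `localKerOver_eq_awayKer`, `localKerOver_le_unramKer` (X2's `localKerOver_le_unramKer` WITHOUT
  `HasGoodReductionAt`), and the full LINK `localKerOver_eq_unramKer` (`hI`, `hD` as in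
  `unramKer_le_awayKer`) with its cyclotomic form — classical = GV at every `v ∤ p`.

References: Greenberg, LNM 1716 (1999) §2 Prop. 2.1, pp. 69–72 [GreenbergLNM1716]; Greenberg–Vatsal,
Invent. Math. 142 (2000) §2 p. 17 [GreenbergVatsal2000]; Silverman AEC VII.3.1, VII.6.3, X.4
[SilvermanAEC2009]; Serre, *Galois Cohomology* II.§1.
-/

set_option autoImplicit false

noncomputable section

open scoped Classical Pointwise

universe u

namespace Summit.BirchSwinnertonDyer.Rank1Residual.Additive

open Literature.NumberTheory.GaloisRepresentations Literature.NumberTheory.EllipticCurves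
  Literature.NumberTheory.EllipticCurves.ResKernel
  Summit.BirchSwinnertonDyer.Rank1Residual.X2.GreenbergVatsalUnramifiedAway
  NumberField IsDedekindDomain Field Literature.NumberTheory.EllipticCurves.GreenbergSelmer
  Summit.BirchSwinnertonDyer.Rank1Residual.X2.GreenbergVatsalTorsion
  Summit.BirchSwinnertonDyer.Rank1Residual.X2.GreenbergVatsalTorsionCurve

section AnyPlace

variable {K : Type u} [Field K] [NumberField K] {p : ℕ} [hp : Fact p.Prime] (κ : ZpExtension K p)
  (v : HeightOneSpectrum (𝓞 K))

variable (W : WeierstrassCurve K) [W.IsElliptic] (p)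

/-- **The classical local condition over `K_∞` at `v ∤ p` is "locally trivial"** (Greenberg's
`Im κ_η = 0` for `η ∤ p`, LNM 1716 Prop. 2.1), for ANY `ℤ_p`-extension, ANY `v ∤ p` and ANY
reduction type: a class of `H¹(K_∞, E[p^∞])` dying in `H¹(H_{K_v}, E(K̄_v))` dies on `H ⊓ D_v`.
[cite: GreenbergLNM1716, §2 Prop. 2.1 (p. 72) and pp. 69–70]
[cite: GreenbergVatsal2000, §2 p. 17] -/
theorem localKerOver_le_awayKer (hpv : ((p : ℕ) : 𝓞 K) ∉ v.asIdeal) :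
    W.localKerOver p κ.kerSubgroup (v.adicCompletion K) ≤
      awayKer κ.kerSubgroup (W.geomPrimaryTorsion p) v := by
  intro c hc
  obtain ⟨f, rfl⟩ :=
    oneCocycleClass_surjective (discreteTopRep κ.kerSubgroup (W.geomPrimaryTorsion p)) c
  obtain ⟨P, hP⟩ := (X2.GreenbergVatsalSelmerLink.oneCocycleClass_mem_localKerOver_iff W p
    κ.kerSubgroup _ f).1 hc
  rw [awayKer, AddMonoidHom.mem_ker, resOfLe_oneCocycleClass_eq_zero_iff κ.kerSubgroup]
  haveI : NeZero p := ⟨hp.out.ne_zero⟩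
  -- a common exponent `p^k` killing every value of `f` (`H` is compact, the values are discrete)
  haveI : CompactSpace (absoluteGaloisGroup K) := absoluteGaloisGroup_compactSpace K
  haveI : CompactSpace ↥κ.kerSubgroup :=
    isCompact_iff_compactSpace.mp κ.isClosed_kerSubgroup.isCompact
  have hfin : (Set.range f.1).Finite := (isCompact_range f.1.continuous).finite_of_discrete
  obtain ⟨k, hk⟩ : ∃ k : ℕ, ∀ x : ↥κ.kerSubgroup,
      (p ^ k : ℕ) • ((f.1 x : W.geomPrimaryTorsion p) : W.geomPoints) = 0 := by
    let e : W.geomPrimaryTorsion p → ℕ := fun m ↦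
      ((AddCommGroup.mem_primaryComponent).1 m.2).choose
    have he : ∀ m : W.geomPrimaryTorsion p, (p ^ e m : ℕ) • (m : W.geomPoints) = 0 := fun m ↦
      ((AddCommGroup.mem_primaryComponent).1 m.2).choose_spec
    refine ⟨hfin.toFinset.sup e, fun x ↦ ?_⟩
    have hle : e (f.1 x) ≤ hfin.toFinset.sup e :=
      Finset.le_sup (hfin.mem_toFinset.mpr ⟨x, rfl⟩)
    obtain ⟨d, hd⟩ := Nat.exists_eq_add_of_le hle
    rw [hd, pow_add, mul_nsmul, he, nsmul_zero]
  -- `S = p^k • P` is fixed by `H_{K_v}`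
  have hS : ∀ τ ∈ localSubgroup κ.kerSubgroup (v.adicCompletion K),
      τ • ((p ^ k : ℕ) • P) = (p ^ k : ℕ) • P := fun τ hτ ↦ by
    have e : (p ^ k : ℕ) • (τ • P - P) = 0 := by
      rw [← hP ⟨τ, hτ⟩, ← map_nsmul, hk, map_zero]
    rw [nsmul_sub, sub_eq_zero] at e
    rw [smul_comm, e]
  -- FILE A of row T-E3g-DOOR: `S = p^k • R + T`, `R` fixed by `H_{K_v} ⊇ I_{K_v}`,
  -- `T` of `p`-power order
  obtain ⟨R, hR, hT⟩ := exists_fixed_sub_pow_nsmul_mem_primaryComponent W p v hpv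
    (localSubgroup κ.kerSubgroup (v.adicCompletion K))
    (absInertia_le_localSubgroup_kerSubgroup (K := K) (p := p) (v := v) κ hpv) _ hS k
  -- `Q₀ = P - R` is `p`-power torsion, hence geometric
  have hQ₀ : P - R ∈ AddCommGroup.primaryComponent (localPoints W (v.adicCompletion K)) p := by
    refine PrimaryCoinvariants.mem_primaryComponent_of_nsmul_mem p (k := k) ?_
    rwa [nsmul_sub]
  obtain ⟨j, hj⟩ := (PrimaryCoinvariants.mem_primaryComponent_iff_exists_nsmul p _).mp hQ₀
  have hn : ((p ^ j : ℕ) : ℤ) ≠ 0 := by exact_mod_cast pow_ne_zero j hp.out.ne_zero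
  let Q₁ : AddSubgroup.torsionBy (localPoints W (v.adicCompletion K)) ((p ^ j : ℕ) : ℤ) :=
    ⟨P - R, AddSubgroup.torsionBy.nsmul_iff.mpr hj⟩
  let Qg : W.geomTorsion ((p ^ j : ℕ) : ℤ) :=
    (W.torsionPointsEquiv ((p ^ j : ℕ) : ℤ) (E := v.adicCompletion K) hn).symm Q₁
  have hQg : pointsMap W (v.adicCompletion K) (Qg : W.geomPoints) = P - R :=
    W.pointsMap_torsionPointsEquiv_symm ((p ^ j : ℕ) : ℤ) hn Q₁
  refine ⟨⟨(Qg : W.geomPoints), X11b.Levels.geomTorsion_pow_le_geomPrimaryTorsion W p j Qg.2⟩,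
    fun σ ↦ ?_⟩
  -- lift `σ ∈ H ⊓ D_v` to `τ ∈ H_{K_v}` and read `f(σ) = ∂P(τ) = ∂Q(τ)`
  obtain ⟨τ, hτσ⟩ := (mem_decomp_iff v _).1 (Subgroup.mem_inf.1 σ.2).2
  have hτσ' : resGal (K := K) (v.adicCompletion K) τ = (σ : absoluteGaloisGroup K) := by
    rw [WeierstrassCurve.resGal_eq_absGaloisRestrict]; exact hτσ
  have hτH : τ ∈ localSubgroup κ.kerSubgroup (v.adicCompletion K) := by
    rw [mem_localSubgroup_iff, hτσ']; exact (Subgroup.mem_inf.1 σ.2).1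
  have e : resGalSubgroup κ.kerSubgroup (v.adicCompletion K) ⟨τ, hτH⟩ =
      subgroupInclusion (inf_le_left : κ.kerSubgroup ⊓ decomp v ≤ κ.kerSubgroup) σ := by
    apply Subtype.ext
    rw [resGalSubgroup_apply_coe, subgroupInclusion_apply_coe]
    exact hτσ'
  have key := hP ⟨τ, hτH⟩
  rw [e] at key
  apply Subtype.ext
  apply pointsMapOfEmb_injective W (closureEmb (K := K) (v.adicCompletion K))
  change pointsMap W (v.adicCompletion K) _ = pointsMap W (v.adicCompletion K) _
  rw [key, AddSubgroupClass.coe_sub, map_sub, primaryComponent.coe_smul, ← hτσ',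
    pointsMap_smul W (v.adicCompletion K) τ, hQg, smul_sub, hR τ hτH]
  abel

/-- **Classical = locally trivial over `K_∞` at every `v ∤ p`** (with X2's
`awayKer_le_localKerOver`). [cite: GreenbergLNM1716, §2 Prop. 2.1 (p. 72)] -/
theorem localKerOver_eq_awayKer (hpv : ((p : ℕ) : 𝓞 K) ∉ v.asIdeal) :
    W.localKerOver p κ.kerSubgroup (v.adicCompletion K) =
      awayKer κ.kerSubgroup (W.geomPrimaryTorsion p) v :=
  le_antisymm (localKerOver_le_awayKer (κ := κ) (v := v) (W := W) (p := p) hpv)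
    (awayKer_le_localKerOver (v := v) (W := W) (p := p) κ.kerSubgroup)

/-- **Classical ⇒ unramified over `K_∞` at every `v ∤ p`, ANY reduction** — X2's
`GreenbergVatsalSelmerLink.localKerOver_le_unramKer` without `HasGoodReductionAt`
(`Sel_E(K_∞)_p ⊆ S_A(K_∞)` at the bad `η ∤ p`). [cite: GreenbergLNM1716, §2 pp. 69–70]
[cite: GreenbergVatsal2000, §2 p. 17] -/
theorem localKerOver_le_unramKer (hpv : ((p : ℕ) : 𝓞 K) ∉ v.asIdeal) :
    W.localKerOver p κ.kerSubgroup (v.adicCompletion K) ≤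
      unramKer κ.kerSubgroup (W.geomPrimaryTorsion p) v :=
  (localKerOver_le_awayKer (κ := κ) (v := v) (W := W) (p := p) hpv).trans
    (awayKer_le_unramKer (H := κ.kerSubgroup) (M := W.geomPrimaryTorsion p) v)

/-- **THE LINK at every `v ∤ p`: classical = unramified over `K_∞`** (`v` not totally split in
`K_∞/K`; `I_v ≤ ker κ` is the unramifiedness of `K_∞/K` at `v ∤ p`), ANY reduction type — the
local conditions of `Sel_E(K_∞)_p` and of `S_A(K_∞)` at `η ∤ p` coincide.
[cite: GreenbergVatsal2000, §2 p. 17] [cite: GreenbergLNM1716, §2 Prop. 2.1, pp. 69–72] -/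
theorem localKerOver_eq_unramKer (hpv : ((p : ℕ) : 𝓞 K) ∉ v.asIdeal)
    (hI : inertia v ≤ κ.kerSubgroup) (hD : ¬ decomp v ≤ κ.kerSubgroup) :
    W.localKerOver p κ.kerSubgroup (v.adicCompletion K) =
      unramKer κ.kerSubgroup (W.geomPrimaryTorsion p) v := by
  rw [localKerOver_eq_awayKer (κ := κ) (v := v) (W := W) (p := p) hpv,
    unramKer_eq_awayKer (κ := κ) (v := v) (W := W) (p := p) hI hD]

end AnyPlace

/-! ## The cyclotomic tower (X2 §2 is stated over `K : Type`) -/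

section Cyclotomic

variable {K : Type} [Field K] [NumberField K] {p : ℕ} [Fact p.Prime] (κ : ZpExtension K p)
  (v : HeightOneSpectrum (𝓞 K))

variable (W : WeierstrassCurve K) [W.IsElliptic] (p)

/-- **The cyclotomic tower, any `v ∤ p`, any reduction: classical = unramified over `K_∞`.**
[cite: GreenbergVatsal2000, §2 p. 17] [cite: GreenbergLNM1716, §2 Prop. 2.1, pp. 69–72] -/
theorem localKerOver_eq_unramKer_of_isCyclotomic (hκ : κ.IsCyclotomic)
    (hpv : ((p : ℕ) : 𝓞 K) ∉ v.asIdeal) :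
    W.localKerOver p κ.kerSubgroup (v.adicCompletion K) =
      unramKer κ.kerSubgroup (W.geomPrimaryTorsion p) v :=
  localKerOver_eq_unramKer (κ := κ) (v := v) (W := W) (p := p) hpv
    (inertia_le_kerSubgroup_of_isCyclotomic κ v hκ hpv)
    (not_decomp_le_kerSubgroup_of_isCyclotomic κ v hκ hpv)

end Cyclotomic

end Summit.BirchSwinnertonDyer.Rank1Residual.Additive

end
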